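import Summits.BirchSwinnertonDyer.BirchSwinnertonDyer.Theorems.GenusKolyvaginAtTwoCasselsTatePairingRat
import Summits.BirchSwinnertonDyer.BirchSwinnertonDyer.Theorems.GenusKolyvaginAtTwoGenusPrimitiveSupplyAtTwoDualityDischarged
import HarnessLib

/-!
# Crux 22136 `GenusPrimitiveSupplyAtTwo`: the Cassels–Tate antecedent DROPPED from the by-name closers

Route `GenusKolyvaginAtTwo`, crux `GenusPrimitiveSupplyAtTwo` (stmt-BirchSwinnertonDyer-22136); seat `bsd-line-gk2-p1` g13 (LEAD,
cell `bsd-f1-sign2`), `--supports 22136`, helper. THEOREMS ONLY (no definition, no named fact, no `sorry`).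

Route item 19420 `CasselsTatePairingRat` is a THEOREM (`casselsTatePairingRat_proof`, `WeierstrassCurve.exists_casselsTate_pairing_holds`,
file `…GenusKolyvaginAtTwoCasselsTatePairingRat`). This file re-issues the lineage's conditional closers of
`…GenusPrimitiveSupplyAtTwoDualityDischarged` (§3–§4) with the Cassels–Tate binder `hCT` fed:

* `minimalSelmerTwinSupply_of_modularity_of_parity` — (SUPPLY) for the habitat from {Modularity, 2-parity} only;
* `stub_minimalTwinSupplyAtTwo_of_modularity_of_parity_of_twoConverse` — the registered stub A of line `genus-supply` from
  {Modularity, 2-parity} ∧ (CONV₂);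
* `genusPrimitiveSupplyAtTwo_of_modularity_of_parity_of_grossZagier_of_twoConverse_of_multiGenus` — THE CRUX BY NAME modulo
  {Modularity, 2-parity, Gross–Zagier (all levels)} print ∧ (CONV₂) ∧ (U);
* `genusPrimitiveSupplyAtTwo_of_kernels_CT` — in route-item vocabulary: `MultiGenusPrimitivityAtTwo → RankOneTwoConverse →
  RankOneTwoConverseOffSemistableAtTwo → ModularityExistsNewform → TwoParityDD → GrossZagierAllLevels → GenusPrimitiveSupplyAtTwo`
  (items 24947, 19220, 24948, 19382, 24949, 24148 — item 19420 gone).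

Honest framing: crux 22136 is OPEN exactly at (U) = item 24947 ∧ (CONV₂) = items 19220/24948 (open problems in print); this file
only removes one PRINT antecedent, now proved in the tree. BSD is not proved by any of this.

References: [MazurRubin2010] Prop. 3.3, Cor. 3.4 (i), Lemma 3.6, Prop. 5.2; [Cassels1962ArithmeticIV]; [GrossZagier1986] Thm. I.6.3;
[DokchitserDokchitserAnnals2010] Thm. 1.4; [GrossLMS1991] §3 (3.5), §4 (4.1).
-/

set_option linter.dupNamespace false -- tree convention: `Summit.BirchSwinnertonDyer.BirchSwinnertonDyer.Theorems` (summit = sub-problem)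
set_option autoImplicit false

noncomputable section

open scoped Classical

namespace Summit.BirchSwinnertonDyer.BirchSwinnertonDyer.Theorems.GenusKolyLowering

open WeierstrassCurve Field NumberField IsDedekindDomain Function
open Literature.NumberTheory.EllipticCurves Literature.NumberTheory.EllipticCurves.ModularForms
open Literature.NumberTheory.GaloisRepresentations
open Literature.NumberTheory.GaloisCohomology
open Summit.BirchSwinnertonDyer.BirchSwinnertonDyer.Theorems.GenusKoly
open Summit.BirchSwinnertonDyer.BirchSwinnertonDyer.Theses.GenusKolyvaginAtTwo

/-! ## §1 (SUPPLY) and stub A without the Cassels–Tate binder -/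

/-- **(SUPPLY) FOR THE HABITAT FROM TWO PRINT FACTS.** For `W/ℚ` globally minimal, non-CM, `r_an(W) = 0`, `ρ_{W,2^n}` onto for
all `n ≥ 1`: a Kolyvagin-(H2)-admissible Heegner field `K` and a globally minimal twin `Wd ≅ W^{(d_K)}` with `#Sel₂(Wd) = 2` —
GRANTED ONLY Modularity `exists_isNewformOf` and the `2`-parity theorem `p_parity · 2` (`minimalSelmerTwinSupply_of_print` with
the Cassels–Tate pairing now the tree theorem `WeierstrassCurve.exists_casselsTate_pairing_holds`).
[cite: MazurRubin2010, Prop. 5.2 (proof, arXiv:0904.3709 p. 12) with Lemma 3.6 and Cor. 3.4 (i)]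
[cite: DokchitserDokchitserAnnals2010, Thm. 1.4] [cite: Cassels1962ArithmeticIV] [cite: GrossLMS1991, §1 (p. 235)] -/
theorem minimalSelmerTwinSupply_of_modularity_of_parity (hmod : exists_isNewformOf)
    (hpar : ∀ V : WeierstrassCurve ℚ, p_parity V 2) :
    ∀ (W : WeierstrassCurve ℚ) [W.IsElliptic] [W.IsGloballyMinimal] [NeZero (W.conductorNorm ℤ)],
      ¬ W.HasCM → W.analyticRank = 0 → (∀ n : ℕ, 0 < n → W.HasSurjectiveModNGaloisRep ((2 : ℤ) ^ n)) →
      ∃ (K : Type) (_ : Field K) (_ : NumberField K),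
        IsImaginaryQuadratic K ∧ Odd (NumberField.discr K) ∧ NumberField.discr K ≠ -3 ∧
        SatisfiesHeegnerHypothesis (W.conductorNorm ℤ) K ∧
        ¬ IsSquare ((NumberField.discr K : ℚ) * -|W.Δ|) ∧ ¬ IsSquare ((NumberField.discr K : ℚ) * (-(2 * |W.Δ|))) ∧
        ∃ (Wd : WeierstrassCurve ℚ) (_ : Wd.IsElliptic) (_ : Wd.IsGloballyMinimal),
          (∃ C : WeierstrassCurve.VariableChange ℚ, C • W.quadraticTwist (NumberField.discr K : ℚ) = Wd) ∧
          Nat.card (Wd.selmerGroup 2) = 2 :=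
  minimalSelmerTwinSupply_of_print hmod hpar WeierstrassCurve.exists_casselsTate_pairing_holds

/-- **STUB A ⟸ Modularity ∧ `2`-parity ∧ (CONV₂).** The registered stub `stub_minimalTwinSupplyAtTwo` of line `genus-supply`
(crux 22136) VERBATIM from two PRINT facts and the rank-one `2`-converse `hconv` (OPEN: items 19220/24948, here without the
reduction-type clause) — `stub_minimalTwinSupplyAtTwo_of_print_of_twoConverse` with Cassels–Tate fed by
`WeierstrassCurve.exists_casselsTate_pairing_holds`. BSD is not proved by any of this.
[cite: MazurRubin2010, Prop. 5.2 (proof) with Lemma 3.6] [cite: DokchitserDokchitserAnnals2010, Thm. 1.4] [cite: Cassels1962ArithmeticIV] -/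
theorem stub_minimalTwinSupplyAtTwo_of_modularity_of_parity_of_twoConverse (hmod : exists_isNewformOf)
    (hpar : ∀ V : WeierstrassCurve ℚ, p_parity V 2)
    (hconv : ∀ (V : WeierstrassCurve ℚ) [V.IsElliptic] [V.IsGloballyMinimal],
      ¬ V.HasCM → V.selmerCorank 2 = 1 → V.analyticRank = 1) :
    ∀ (W : WeierstrassCurve ℚ) [W.IsElliptic] [W.IsGloballyMinimal] [NeZero (W.conductorNorm ℤ)],
      ¬ W.HasCM → W.analyticRank = 0 → (∀ n : ℕ, 0 < n → W.HasSurjectiveModNGaloisRep ((2 : ℤ) ^ n)) →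
      ∃ (K : Type) (_ : Field K) (_ : NumberField K),
        IsImaginaryQuadratic K ∧ Odd (NumberField.discr K) ∧ NumberField.discr K ≠ -3 ∧
        SatisfiesHeegnerHypothesis (W.conductorNorm ℤ) K ∧
        ¬ IsSquare ((NumberField.discr K : ℚ) * -|W.Δ|) ∧ ¬ IsSquare ((NumberField.discr K : ℚ) * (-(2 * |W.Δ|))) ∧
        ∃ (Wd : WeierstrassCurve ℚ) (_ : Wd.IsElliptic) (_ : Wd.IsGloballyMinimal),
          (∃ C : WeierstrassCurve.VariableChange ℚ, C • W.quadraticTwist (NumberField.discr K : ℚ) = Wd) ∧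
          Wd.analyticRank = 1 ∧ Nat.card (Wd.selmerGroup 2) = 2 :=
  stub_minimalTwinSupplyAtTwo_of_print_of_twoConverse hmod hpar WeierstrassCurve.exists_casselsTate_pairing_holds hconv

/-! ## §2 The crux BY NAME without the Cassels–Tate binder -/

/-- **THE CRUX `GenusPrimitiveSupplyAtTwo` BY NAME modulo Modularity ∧ `2`-parity ∧ Gross–Zagier (print, displayed) ∧ (CONV₂) ∧ (U)**
— `genusPrimitiveSupplyAtTwo_of_print_of_twoConverse_of_multiGenus` with Cassels–Tate fed by
`WeierstrassCurve.exists_casselsTate_pairing_holds`. CONDITIONAL; crux 22136 is OPEN exactly at (CONV₂) ∧ (U).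
BSD is not proved by any of this. [cite: MazurRubin2010, Prop. 5.2 (proof) with Lemma 3.6] [cite: GrossZagier1986, Thm. I.6.3]
[cite: DokchitserDokchitserAnnals2010, Thm. 1.4] [cite: Cassels1962ArithmeticIV] [cite: GrossLMS1991, §3 (3.5), §4 (4.1)] -/
theorem genusPrimitiveSupplyAtTwo_of_modularity_of_parity_of_grossZagier_of_twoConverse_of_multiGenus (hmod : exists_isNewformOf)
    (hpar : ∀ V : WeierstrassCurve ℚ, p_parity V 2)
    (hGZ : ∀ (W : WeierstrassCurve ℚ) [NeZero (W.conductorNorm ℤ)] (K : Type) [Field K] [NumberField K],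
      gross_zagier (W.conductorNorm ℤ) W K)
    (hconv : ∀ (V : WeierstrassCurve ℚ) [V.IsElliptic] [V.IsGloballyMinimal],
      ¬ V.HasCM → V.selmerCorank 2 = 1 → V.analyticRank = 1)
    (hU : MultiGenusPrimitivityAtTwo) : GenusPrimitiveSupplyAtTwo :=
  genusPrimitiveSupplyAtTwo_of_print_of_twoConverse_of_multiGenus hmod hpar WeierstrassCurve.exists_casselsTate_pairing_holds hGZ
    hconv hU

/-- **THE CRUX BY NAME FROM ROUTE ITEMS ONLY, item 19420 GONE**: `MultiGenusPrimitivityAtTwo → RankOneTwoConverse →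
RankOneTwoConverseOffSemistableAtTwo → ModularityExistsNewform → TwoParityDD → GrossZagierAllLevels → GenusPrimitiveSupplyAtTwo` — every
displayed antecedent is an OPEN item of route `GenusKolyvaginAtTwo` (24947, 19220, 24948, 19382, 24949, 24148); the Cassels–Tate
antecedent of `genusPrimitiveSupplyAtTwo_of_kernels` is fed by the closed item's theorem `casselsTatePairingRat_proof`. CONDITIONAL on
its antecedents; the non-print ones are (U) and (CONV₂). BSD is not proved by any of this.
[cite: MazurRubin2010, Prop. 5.2] [cite: GrossZagier1986, Thm. I.6.3] [cite: Cassels1962ArithmeticIV] [cite: GrossLMS1991, §3 (3.5), §4 (4.1)] -/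
theorem genusPrimitiveSupplyAtTwo_of_kernels_CT :
    MultiGenusPrimitivityAtTwo → RankOneTwoConverse → RankOneTwoConverseOffSemistableAtTwo → ModularityExistsNewform → TwoParityDD →
      GrossZagierAllLevels → GenusPrimitiveSupplyAtTwo :=
  fun hU h1 h2 hmod hpar hGZ ↦ genusPrimitiveSupplyAtTwo_of_kernels hU h1 h2 hmod hpar casselsTatePairingRat_proof hGZ

/-! ## R-128 retype (director-bsd 2026-08-29 17:42Z, T-Q381-1′; seat bsd-line-gk2-p2 g21): PRINT-FORM TWINS
Every theorem below is the byte-identical twin of the theorem of the same name without the trailing prime, with the ONE change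
that the `2`-parity hypothesis is typed as print has it — `∀ (V : WeierstrassCurve ℚ) [V.IsElliptic], p_parity V 2`
(Dokchitser–Dokchitser 2010 Thm. 1.4, elliptic curves; = route item `TwoParityDD` after rev 34) — instead of the bare closure
`∀ V : WeierstrassCurve ℚ, p_parity V 2` over all Weierstrass cubics (singular ones included: off print, undischargeable).
Calls to other retyped theorems go to their primed twins; every application `hpar W` is at an elliptic curve, so the proofs are
unchanged. The unprimed originals are kept (append-only tree) and are superseded by these. BSD is NOT proved by any of this. -/

/-- **R-128 retype** (director-bsd 2026-08-29, T-Q381-1′) of `minimalSelmerTwinSupply_of_modularity_of_parity`: the SAME statement and proof with the `2`-parity hypothesis in PRINT form `∀ (V : WeierstrassCurve ℚ) [V.IsElliptic], p_parity V 2` (Dokchitser–Dokchitser 2010 Thm. 1.4 is about elliptic curves; the bare closure over all Weierstrass cubics was off print). **(SUPPLY) FOR THE HABITAT FROM TWO PRINT FACTS.** For `W/ℚ` globally minimal, non-CM, `r_an(W) = 0`, `ρ_{W,2^n}` onto for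
all `n ≥ 1`: a Kolyvagin-(H2)-admissible Heegner field `K` and a globally minimal twin `Wd ≅ W^{(d_K)}` with `#Sel₂(Wd) = 2` —
GRANTED ONLY Modularity `exists_isNewformOf` and the `2`-parity theorem `p_parity · 2` (`minimalSelmerTwinSupply_of_print'` with
the Cassels–Tate pairing now the tree theorem `WeierstrassCurve.exists_casselsTate_pairing_holds`).
[cite: MazurRubin2010, Prop. 5.2 (proof, arXiv:0904.3709 p. 12) with Lemma 3.6 and Cor. 3.4 (i)]
[cite: DokchitserDokchitserAnnals2010, Thm. 1.4] [cite: Cassels1962ArithmeticIV] [cite: GrossLMS1991, §1 (p. 235)] -/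
theorem minimalSelmerTwinSupply_of_modularity_of_parity' (hmod : exists_isNewformOf)
    (hpar : ∀ (V : WeierstrassCurve ℚ) [V.IsElliptic], p_parity V 2) :
    ∀ (W : WeierstrassCurve ℚ) [W.IsElliptic] [W.IsGloballyMinimal] [NeZero (W.conductorNorm ℤ)],
      ¬ W.HasCM → W.analyticRank = 0 → (∀ n : ℕ, 0 < n → W.HasSurjectiveModNGaloisRep ((2 : ℤ) ^ n)) →
      ∃ (K : Type) (_ : Field K) (_ : NumberField K),
        IsImaginaryQuadratic K ∧ Odd (NumberField.discr K) ∧ NumberField.discr K ≠ -3 ∧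
        SatisfiesHeegnerHypothesis (W.conductorNorm ℤ) K ∧
        ¬ IsSquare ((NumberField.discr K : ℚ) * -|W.Δ|) ∧ ¬ IsSquare ((NumberField.discr K : ℚ) * (-(2 * |W.Δ|))) ∧
        ∃ (Wd : WeierstrassCurve ℚ) (_ : Wd.IsElliptic) (_ : Wd.IsGloballyMinimal),
          (∃ C : WeierstrassCurve.VariableChange ℚ, C • W.quadraticTwist (NumberField.discr K : ℚ) = Wd) ∧
          Nat.card (Wd.selmerGroup 2) = 2 :=
  minimalSelmerTwinSupply_of_print' hmod hpar WeierstrassCurve.exists_casselsTate_pairing_holds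

/-- **R-128 retype** (director-bsd 2026-08-29, T-Q381-1′) of `stub_minimalTwinSupplyAtTwo_of_modularity_of_parity_of_twoConverse`: the SAME statement and proof with the `2`-parity hypothesis in PRINT form `∀ (V : WeierstrassCurve ℚ) [V.IsElliptic], p_parity V 2` (Dokchitser–Dokchitser 2010 Thm. 1.4 is about elliptic curves; the bare closure over all Weierstrass cubics was off print). **STUB A ⟸ Modularity ∧ `2`-parity ∧ (CONV₂).** The registered stub `stub_minimalTwinSupplyAtTwo` of line `genus-supply`
(crux 22136) VERBATIM from two PRINT facts and the rank-one `2`-converse `hconv` (OPEN: items 19220/24948, here without the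
reduction-type clause) — `stub_minimalTwinSupplyAtTwo_of_print_of_twoConverse'` with Cassels–Tate fed by
`WeierstrassCurve.exists_casselsTate_pairing_holds`. BSD is not proved by any of this.
[cite: MazurRubin2010, Prop. 5.2 (proof) with Lemma 3.6] [cite: DokchitserDokchitserAnnals2010, Thm. 1.4] [cite: Cassels1962ArithmeticIV] -/
theorem stub_minimalTwinSupplyAtTwo_of_modularity_of_parity_of_twoConverse' (hmod : exists_isNewformOf)
    (hpar : ∀ (V : WeierstrassCurve ℚ) [V.IsElliptic], p_parity V 2)
    (hconv : ∀ (V : WeierstrassCurve ℚ) [V.IsElliptic] [V.IsGloballyMinimal],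
      ¬ V.HasCM → V.selmerCorank 2 = 1 → V.analyticRank = 1) :
    ∀ (W : WeierstrassCurve ℚ) [W.IsElliptic] [W.IsGloballyMinimal] [NeZero (W.conductorNorm ℤ)],
      ¬ W.HasCM → W.analyticRank = 0 → (∀ n : ℕ, 0 < n → W.HasSurjectiveModNGaloisRep ((2 : ℤ) ^ n)) →
      ∃ (K : Type) (_ : Field K) (_ : NumberField K),
        IsImaginaryQuadratic K ∧ Odd (NumberField.discr K) ∧ NumberField.discr K ≠ -3 ∧
        SatisfiesHeegnerHypothesis (W.conductorNorm ℤ) K ∧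
        ¬ IsSquare ((NumberField.discr K : ℚ) * -|W.Δ|) ∧ ¬ IsSquare ((NumberField.discr K : ℚ) * (-(2 * |W.Δ|))) ∧
        ∃ (Wd : WeierstrassCurve ℚ) (_ : Wd.IsElliptic) (_ : Wd.IsGloballyMinimal),
          (∃ C : WeierstrassCurve.VariableChange ℚ, C • W.quadraticTwist (NumberField.discr K : ℚ) = Wd) ∧
          Wd.analyticRank = 1 ∧ Nat.card (Wd.selmerGroup 2) = 2 :=
  stub_minimalTwinSupplyAtTwo_of_print_of_twoConverse' hmod hpar WeierstrassCurve.exists_casselsTate_pairing_holds hconv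

/-- **R-128 retype** (director-bsd 2026-08-29, T-Q381-1′) of `genusPrimitiveSupplyAtTwo_of_modularity_of_parity_of_grossZagier_of_twoConverse_of_multiGenus`: the SAME statement and proof with the `2`-parity hypothesis in PRINT form `∀ (V : WeierstrassCurve ℚ) [V.IsElliptic], p_parity V 2` (Dokchitser–Dokchitser 2010 Thm. 1.4 is about elliptic curves; the bare closure over all Weierstrass cubics was off print). **THE CRUX `GenusPrimitiveSupplyAtTwo` BY NAME modulo Modularity ∧ `2`-parity ∧ Gross–Zagier (print, displayed) ∧ (CONV₂) ∧ (U)**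
— `genusPrimitiveSupplyAtTwo_of_print_of_twoConverse_of_multiGenus'` with Cassels–Tate fed by
`WeierstrassCurve.exists_casselsTate_pairing_holds`. CONDITIONAL; crux 22136 is OPEN exactly at (CONV₂) ∧ (U).
BSD is not proved by any of this. [cite: MazurRubin2010, Prop. 5.2 (proof) with Lemma 3.6] [cite: GrossZagier1986, Thm. I.6.3]
[cite: DokchitserDokchitserAnnals2010, Thm. 1.4] [cite: Cassels1962ArithmeticIV] [cite: GrossLMS1991, §3 (3.5), §4 (4.1)] -/
theorem genusPrimitiveSupplyAtTwo_of_modularity_of_parity_of_grossZagier_of_twoConverse_of_multiGenus' (hmod : exists_isNewformOf)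
    (hpar : ∀ (V : WeierstrassCurve ℚ) [V.IsElliptic], p_parity V 2)
    (hGZ : ∀ (W : WeierstrassCurve ℚ) [NeZero (W.conductorNorm ℤ)] (K : Type) [Field K] [NumberField K],
      gross_zagier (W.conductorNorm ℤ) W K)
    (hconv : ∀ (V : WeierstrassCurve ℚ) [V.IsElliptic] [V.IsGloballyMinimal],
      ¬ V.HasCM → V.selmerCorank 2 = 1 → V.analyticRank = 1)
    (hU : MultiGenusPrimitivityAtTwo) : GenusPrimitiveSupplyAtTwo :=
  genusPrimitiveSupplyAtTwo_of_print_of_twoConverse_of_multiGenus' hmod hpar WeierstrassCurve.exists_casselsTate_pairing_holds hGZ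
    hconv hU


end Summit.BirchSwinnertonDyer.BirchSwinnertonDyer.Theorems.GenusKolyLowering

end
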